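import Mathlib
import HarnessLib
import Summits.ResolutionOfSingularities.ResolutionOfSingularities.Theorems.WildQuotientsWildQuotientResolutionS1aKillFreeFix
import Summits.ResolutionOfSingularities.ResolutionOfSingularities.Theorems.WildQuotientsWildQuotientResolutionS1aKillCertCover

/-!
# S1a — R4e: the `g₀`-FIXED POINTS (hence every carried formal locus) lie in the union of the localised charts `Wᵢ = D(∏_{j≠i} N(x₁ − αⱼ))`

[OURS · L1 W4.5c · lead-1 g17; plan-1 RULING R-F15s ★ R4e-rational `graphTail_killsIn_two`, SPEC §2b (the old formal locus off `⋃ Wᵢ`) — settled WITHOUT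
refining the initial datum: by ✓`NodeAtlasData.fLocus_subset_fixedPoints` (F-T5) the carried formal locus of ANY atlas consists of `g₀`-fixed points, and a
`g₀`-fixed point `u` of the polynomial chart has a `σ`-STABLE prime `𝔭_u` of sections vanishing at `u`; if `𝔭_u` contained every `∏_{j≠i} N(x₁ − αⱼ)` it would
contain two different `x₁ − αⱼ + l x₀`, hence `x₀` (apply `σ`), hence a non-zero constant] — NOT statements of the manuscript; counted 0; AI-level work, weaker
than expert review. Crux stmt-ResolutionOfSingularities-17941 `CyclicQuotientFourfolds`, line `s1a-logminvertex` v13 (`stub_reachLowerInFX`).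

* `GraphTail.false_of_X_zero_mem_of_locPoly_mem` — a proper ideal containing `x₀` and all `∏_{j≠i}∏_l (x₁ − αᵢ + (αᵢ − αⱼ) + l x₀)` (`α` injective, `0 < r`), prime: impossible;
* `GraphTail.false_of_sigma_stable_of_locPoly_mem` — the same for a `σ`-stable prime (`σx₁ = x₁ + x₀`), without assuming `x₀ ∈ 𝔭`;
* ★ `GameFrame.GModel.exists_mem_basicOpen_locPoly_of_fixed` — on a `G`-stable affine polynomial chart `(O, e, σ)`: every `g₀`-fixed point of `O` lies in some
  `D(bᵢ)`, `e bᵢ = ∏_{j≠i}∏_l (x₁ − αᵢ + (αᵢ − αⱼ) + l x₀)`; `mem_basicOpen_X_zero_or_locPoly` — every point of `O` lies in `D(e⁻¹x₀)` or in some `D(bᵢ)`;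
  `fLocus_subset_iUnion_basicOpen_locPoly` — the carried formal locus of every atlas (chart `O = ⊤`) lies in `⋃ᵢ D(bᵢ)`.
-/

set_option linter.dupNamespace false

noncomputable section

open CategoryTheory Limits AlgebraicGeometry TopologicalSpace Topology Opposite MvPolynomial
open Literature.AlgebraicGeometry.Resolution Literature.AlgebraicGeometry.RelativeSpec
open Summit.ResolutionOfSingularities.ResolutionOfSingularities.Theorems.WildQuotientResolution.S1
open Summit.ResolutionOfSingularities.ResolutionOfSingularities.Theorems.WildQuotientResolution.S1.NodeAtlas
open Summit.ResolutionOfSingularities.ResolutionOfSingularities.Theorems.WildQuotientResolution.S1.NpFrame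
open Summit.ResolutionOfSingularities.ResolutionOfSingularities.Theorems.WildQuotientResolution.S1.GoodCharts

namespace Summit.ResolutionOfSingularities.ResolutionOfSingularities.Theorems.WildQuotientResolution.S1.GraphTail

variable {k : Type} [Field k] {p : ℕ}

/-- **A prime containing `x₀` and every `∏_{j≠i}∏_l (x₁ − αᵢ + (αᵢ − αⱼ) + l·x₀)` (`α` injective, `0 < r`) does not exist.** [OURS · L1 W4.5c · R4e; folklore] -/
theorem false_of_X_zero_mem_of_locPoly_mem [NeZero p] (Q : Ideal (MvPolynomial (Fin 4) k)) [hQ : Q.IsPrime]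
    {r : ℕ} (hr : 0 < r) (α : Fin r → k) (hα : Function.Injective α) (hX0 : (X 0 : MvPolynomial (Fin 4) k) ∈ Q)
    (hh : ∀ i : Fin r, (∏ j ∈ Finset.univ.erase i, ∏ l : ZMod p, (X 1 - C (α i) + C (α i - α j) + (l.val : MvPolynomial (Fin 4) k) * X 0)) ∈ Q) : False := by
  classical
  -- from `hh i`: some `x₁ − αⱼ ∈ Q` with `j ≠ i`
  have key : ∀ i : Fin r, ∃ j, j ≠ i ∧ (X 1 - C (α j) : MvPolynomial (Fin 4) k) ∈ Q := by
    intro i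
    obtain ⟨j, hj, hjQ⟩ := Ideal.IsPrime.prod_mem_iff.mp (hh i)
    obtain ⟨l, -, hlQ⟩ := Ideal.IsPrime.prod_mem_iff.mp hjQ
    refine ⟨j, Finset.ne_of_mem_erase hj, ?_⟩
    have h1 : (X 1 - C (α j) : MvPolynomial (Fin 4) k) =
        (X 1 - C (α i) + C (α i - α j) + (l.val : MvPolynomial (Fin 4) k) * X 0) - (l.val : MvPolynomial (Fin 4) k) * X 0 := by
      rw [map_sub]; ring
    rw [h1]
    exact Q.sub_mem hlQ (Q.mul_mem_left _ hX0)
  obtain ⟨j₁, -, hj₁⟩ := key ⟨0, hr⟩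
  obtain ⟨j₂, hne, hj₂⟩ := key j₁
  have hc : (C (α j₂ - α j₁) : MvPolynomial (Fin 4) k) ∈ Q := by
    have h1 : (C (α j₂ - α j₁) : MvPolynomial (Fin 4) k) = (X 1 - C (α j₁)) - (X 1 - C (α j₂)) := by rw [map_sub]; ring
    rw [h1]
    exact Q.sub_mem hj₁ hj₂
  have hu : IsUnit (C (α j₂ - α j₁) : MvPolynomial (Fin 4) k) :=
    (isUnit_iff_ne_zero.mpr (sub_ne_zero.mpr fun h => hne (hα h))).map C
  exact hQ.ne_top (Q.eq_top_of_isUnit_mem hc hu)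

/-- **A `σ`-stable prime (`σ x₁ = x₁ + x₀`) containing every `∏_{j≠i}∏_l (x₁ − αᵢ + (αᵢ − αⱼ) + l·x₀)` does not exist**: it contains some `x₁ − αⱼ + l x₀` and its
`σ`-image, hence `x₀`. [OURS · L1 W4.5c · R4e; folklore] -/
theorem false_of_sigma_stable_of_locPoly_mem [NeZero p] (Q : Ideal (MvPolynomial (Fin 4) k)) [hQ : Q.IsPrime]
    (σ : MvPolynomial (Fin 4) k ≃+* MvPolynomial (Fin 4) k) (hC : ∀ a : k, σ (C a) = C a) (h0 : σ (X 0) = X 0) (h1 : σ (X 1) = X 1 + X 0)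
    (hσQ : ∀ f, f ∈ Q → σ f ∈ Q)
    {r : ℕ} (hr : 0 < r) (α : Fin r → k) (hα : Function.Injective α)
    (hh : ∀ i : Fin r, (∏ j ∈ Finset.univ.erase i, ∏ l : ZMod p, (X 1 - C (α i) + C (α i - α j) + (l.val : MvPolynomial (Fin 4) k) * X 0)) ∈ Q) : False := by
  classical
  obtain ⟨j, -, hjQ⟩ := Ideal.IsPrime.prod_mem_iff.mp (hh ⟨0, hr⟩)
  obtain ⟨l, -, hlQ⟩ := Ideal.IsPrime.prod_mem_iff.mp hjQ
  have hσL : σ (X 1 - C (α ⟨0, hr⟩) + C (α ⟨0, hr⟩ - α j) + (l.val : MvPolynomial (Fin 4) k) * X 0) =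
      (X 1 - C (α ⟨0, hr⟩) + C (α ⟨0, hr⟩ - α j) + (l.val : MvPolynomial (Fin 4) k) * X 0) + X 0 := by
    rw [map_add, map_add, map_sub, map_mul, map_natCast, h1, h0, hC, hC]; ring
  have hX0 : (X 0 : MvPolynomial (Fin 4) k) ∈ Q := by
    have h := Q.sub_mem (hσQ _ hlQ) hlQ
    rwa [hσL, add_sub_cancel_left] at h
  exact false_of_X_zero_mem_of_locPoly_mem Q hr α hα hX0 hh

end Summit.ResolutionOfSingularities.ResolutionOfSingularities.Theorems.WildQuotientResolution.S1.GraphTail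

namespace Summit.ResolutionOfSingularities.ResolutionOfSingularities.Theorems.WildQuotientResolution.S1.GameFrame.GModel

variable {p : ℕ} {X' X₁ : Scheme.{0}} {q : X' ⟶ X₁} {G : Type} [Group G] {ρ : G →* Aut X'} {g₀ : G}

/-- ★ **Every `g₀`-FIXED point of a `G`-stable affine polynomial chart `(O, e, σ)` in R4 position (`σx₀ = x₀`, `σx₁ = x₁ + x₀`) lies in some `D(bᵢ)`**,
`e bᵢ = ∏_{j≠i}∏_l (x₁ − αᵢ + (αᵢ − αⱼ) + l x₀)` (`α` injective, `0 < r`). [OURS · L1 W4.5c · R4e; NOT a statement of the manuscript] -/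
theorem exists_mem_basicOpen_locPoly_of_fixed [NeZero p] (M : GModel p q G ρ g₀) (O : M.act.StableAffineOpens)
    {k : Type} [Field k] (e : Γ(M.V, O.1) ≃+* MvPolynomial (Fin 4) k) (σ : MvPolynomial (Fin 4) k ≃+* MvPolynomial (Fin 4) k)
    (hC : ∀ a : k, σ (C a) = C a) (h0 : σ (X 0) = X 0) (h1 : σ (X 1) = X 1 + X 0)
    (hact : ∀ t : Γ(M.V, O.1), actOEquiv M.act O g₀ t = e.symm (σ (e t)))
    {r : ℕ} (hr : 0 < r) (α : Fin r → k) (hα : Function.Injective α) (b : Fin r → Γ(M.V, O.1))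
    (hb : ∀ i, e (b i) = ∏ j ∈ Finset.univ.erase i, ∏ l : ZMod p, (X 1 - C (α i) + C (α i - α j) + (l.val : MvPolynomial (Fin 4) k) * X 0))
    {u : M.V} (hu : u ∈ O.1) (hfix : (M.act.aut g₀).hom.base u = u) : ∃ i, u ∈ M.V.basicOpen (b i) := by
  classical
  by_contra hcon
  push Not at hcon
  -- the prime of polynomials whose `e⁻¹`-image vanishes at `u`
  let Q : Ideal (MvPolynomial (Fin 4) k) := (idealOfPoint O.1 u hu).comap (e.symm : MvPolynomial (Fin 4) k →+* Γ(M.V, O.1))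
  haveI : (idealOfPoint O.1 u hu).IsPrime := isPrime_idealOfPoint O.1 u hu
  haveI hQ : Q.IsPrime := Ideal.IsPrime.comap _
  have hmem : ∀ f : MvPolynomial (Fin 4) k, f ∈ Q ↔ u ∉ M.V.basicOpen (e.symm f) := fun f => by
    rw [← not_mem_idealOfPoint_iff O.1 u hu, not_not]; rfl
  -- `σ`-stability: `e⁻¹(σ f) = g₀ · e⁻¹ f` and `g₀⁻¹ u = u`
  have hinv : (M.act.aut g₀⁻¹).hom.base u = u := by
    conv_lhs => rw [← hfix]
    have := aut_base_aut_inv_base M.act g₀⁻¹ u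
    rwa [inv_inv] at this
  have hσQ : ∀ f, f ∈ Q → σ f ∈ Q := fun f hf => by
    rw [hmem] at hf ⊢
    have hσ : e.symm (σ f) = actO M.act O g₀ (e.symm f) := by
      have h := hact (e.symm f)
      rw [e.apply_symm_apply, actOEquiv_apply] at h
      exact h.symm
    rw [hσ, mem_basicOpen_actO_iff M.act O g₀ (e.symm f) u hu, hinv]
    exact hf
  refine GraphTail.false_of_sigma_stable_of_locPoly_mem (p := p) Q σ hC h0 h1 hσQ hr α hα fun i => ?_
  rw [hmem, ← hb i, e.symm_apply_apply]
  exact hcon i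

/-- **Every point of the chart lies in `D(e⁻¹x₀)` or in some `D(bᵢ)`.** [OURS · L1 W4.5c · R4e; NOT a statement of the manuscript] -/
theorem mem_basicOpen_X_zero_or_locPoly [NeZero p] (M : GModel p q G ρ g₀) (O : M.act.StableAffineOpens)
    {k : Type} [Field k] (e : Γ(M.V, O.1) ≃+* MvPolynomial (Fin 4) k)
    {r : ℕ} (hr : 0 < r) (α : Fin r → k) (hα : Function.Injective α) (b : Fin r → Γ(M.V, O.1))
    (hb : ∀ i, e (b i) = ∏ j ∈ Finset.univ.erase i, ∏ l : ZMod p, (X 1 - C (α i) + C (α i - α j) + (l.val : MvPolynomial (Fin 4) k) * X 0))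
    {u : M.V} (hu : u ∈ O.1) : u ∈ M.V.basicOpen (e.symm (X 0)) ∨ ∃ i, u ∈ M.V.basicOpen (b i) := by
  classical
  by_contra hcon
  push Not at hcon
  let Q : Ideal (MvPolynomial (Fin 4) k) := (idealOfPoint O.1 u hu).comap (e.symm : MvPolynomial (Fin 4) k →+* Γ(M.V, O.1))
  haveI : (idealOfPoint O.1 u hu).IsPrime := isPrime_idealOfPoint O.1 u hu
  haveI hQ : Q.IsPrime := Ideal.IsPrime.comap _
  have hmem : ∀ f : MvPolynomial (Fin 4) k, f ∈ Q ↔ u ∉ M.V.basicOpen (e.symm f) := fun f => by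
    rw [← not_mem_idealOfPoint_iff O.1 u hu, not_not]; rfl
  refine GraphTail.false_of_X_zero_mem_of_locPoly_mem (p := p) Q hr α hα ((hmem _).mpr hcon.1) fun i => ?_
  rw [hmem, ← hb i, e.symm_apply_apply]
  exact hcon.2 i

/-- ★ **THE CARRIED FORMAL LOCUS OF EVERY ATLAS LIES IN `⋃ᵢ D(bᵢ)`** (chart `O` containing every point, e.g. `O = ⊤` of an affine model).
[OURS · L1 W4.5c · R4e SPEC §2b; NOT a statement of the manuscript] -/
theorem fLocus_subset_iUnion_basicOpen_locPoly [NeZero p] [Finite G] (hG : ∀ g : G, g ∈ Subgroup.zpowers g₀) (M : GModel p q G ρ g₀) (O : M.act.StableAffineOpens)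
    (hO : ∀ u : M.V, u ∈ O.1)
    {k : Type} [Field k] (e : Γ(M.V, O.1) ≃+* MvPolynomial (Fin 4) k) (σ : MvPolynomial (Fin 4) k ≃+* MvPolynomial (Fin 4) k)
    (hC : ∀ a : k, σ (C a) = C a) (h0 : σ (X 0) = X 0) (h1 : σ (X 1) = X 1 + X 0)
    (hact : ∀ t : Γ(M.V, O.1), actOEquiv M.act O g₀ t = e.symm (σ (e t)))
    {r : ℕ} (hr : 0 < r) (α : Fin r → k) (hα : Function.Injective α) (b : Fin r → Γ(M.V, O.1))
    (hb : ∀ i, e (b i) = ∏ j ∈ Finset.univ.erase i, ∏ l : ZMod p, (X 1 - C (α i) + C (α i - α j) + (l.val : MvPolynomial (Fin 4) k) * X 0))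
    (𝔄 : NodeAtlasData p M.act g₀) : 𝔄.fLocus ⊆ ⋃ i, (M.V.basicOpen (b i) : Set M.V) := fun u hu =>
  Set.mem_iUnion.mpr (exists_mem_basicOpen_locPoly_of_fixed M O e σ hC h0 h1 hact hr α hα b hb (hO u) (𝔄.fLocus_subset_fixedPoints hG hu))

end Summit.ResolutionOfSingularities.ResolutionOfSingularities.Theorems.WildQuotientResolution.S1.GameFrame.GModel

end
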